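import Summits.NavierStokesRegularity.NavierStokesRegularity.Theses.WakeRatchet
import Summits.NavierStokesRegularity.NavierStokesRegularity.Theorems.WakeRatchetEternalViscousRateDissipativeRung

/-!
# LINE g10-3 — `stub_tailLimit` PROVED: FINAL TAILS EXIST

For every admissible, uniformly bounded eternal solution `W` of the renormalised inviscid lattice of a
cancelling table (`ε₀ > 0`) and every shell `n`, the physical tail energy
`T_n(σ) = Σ_k physEnergy ε₀ W (n+k) σ` converges as `σ → ∞`.  Proof: termwise differentiation
(`hasDerivAt_tsum_of_isPreconnected` on `Iio (σ+1)`, geometric derivative bounds from `UniformBound`)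
gives `T_n' = Σ_k (F_{n+k-1} − F_{n+k}) = F_{n-1}` (telescoping, `F_{n+K} → 0`); the incoming flux
`F_{n-1}` is integrable on a right half-line (`abs_physFlux_le`, `IsEternal.bdd/action`), so `T_n`
converges (`tendsto_limUnder_of_hasDerivAt_of_integrableOn_Ioi`).  Registered stub of the conveyor
ledger (skeleton v4, namespace `…Cruxes.EternalInviscidRate.FinalWakeLedger`), same name and signature;
sorry-free.  Model lattice only; nothing about NS.  No summit is proved by a line.
-/

set_option linter.dupNamespace false

open Filter Topology MeasureTheory Set
open Literature.Analysis.FluidPDE.TaoCascade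

namespace Summit.NavierStokesRegularity.NavierStokesRegularity.Cruxes.EternalInviscidRate.FinalWakeLedger

-- `Λ > 1` for `ε₀ > 0`: the landed `EternalViscousRate.DissipationEdge.one_lt_bigLam` (p676906) is used by name (dedup lint).

/-- Under a uniform bound `‖W_k‖ ≤ C`, the physical energy of shell `j` at log-times `y ≤ b` is at
most `Λ^{-2j} e^{2b} C²`. -/
theorem physEnergy_le_unif {m : ℕ} {ε₀ : ℝ} {W : ℤ → ℝ → Em m} {C : ℝ}
    (hC : ∀ (k : ℤ) (σ : ℝ), ‖W k σ‖ ≤ C) (j : ℤ) {y b : ℝ} (hy : y ≤ b) :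
    physEnergy ε₀ W j y ≤ (bigLam ε₀ ^ j)⁻¹ ^ 2 * (Real.exp (2 * b) * C ^ 2) := by
  unfold physEnergy
  refine mul_le_mul_of_nonneg_left ?_ (sq_nonneg _)
  have h1 : Real.exp (2 * y) ≤ Real.exp (2 * b) := Real.exp_le_exp.mpr (by linarith)
  have h2 : ‖W j y‖ ^ 2 ≤ C ^ 2 := pow_le_pow_left₀ (norm_nonneg _) (hC j y) 2
  exact mul_le_mul h1 h2 (sq_nonneg _) (Real.exp_pos _).le

/-- Flux bound under a uniform bound: `|F_j(y)| ≤ c C · Λ^{-2j} e^{2b} C²` for `y ≤ b`. -/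
theorem abs_physFlux_le_unif {ε₀ : ℝ} (hε : 0 < ε₀)
    {α : Fin 4 → Fin 4 → Fin 4 → ℤ × ℤ × ℤ → ℝ} (hc : IsCancellingCoeff α)
    {W : ℤ → ℝ → Em 4} {C : ℝ} (hC : ∀ (k : ℤ) (σ : ℝ), ‖W k σ‖ ≤ C) (j : ℤ) {y b : ℝ}
    (hy : y ≤ b) :
    |physFlux ε₀ α W j y|
      ≤ 2 * fluxConst α * (bigLam ε₀)⁻¹ * C * ((bigLam ε₀ ^ j)⁻¹ ^ 2 * (Real.exp (2 * b) * C ^ 2)) := by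
  have h := abs_physFlux_le hε hc W j y
  have hΛ : 0 < bigLam ε₀ := bigLam_pos (by linarith)
  have hc0 : 0 ≤ 2 * fluxConst α * (bigLam ε₀)⁻¹ := by
    have := fluxConst_nonneg α; positivity
  have hC0 : 0 ≤ C := (norm_nonneg _).trans (hC j y)
  calc |physFlux ε₀ α W j y|
      ≤ 2 * fluxConst α * (bigLam ε₀)⁻¹ * ‖W (j + 1) y‖ * physEnergy ε₀ W j y := h
    _ ≤ 2 * fluxConst α * (bigLam ε₀)⁻¹ * C * ((bigLam ε₀ ^ j)⁻¹ ^ 2 * (Real.exp (2 * b) * C ^ 2)) := by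
        refine mul_le_mul (mul_le_mul_of_nonneg_left (hC _ _) hc0)
          (physEnergy_le_unif hC j hy) (physEnergy_nonneg _ _ _ _) ?_
        exact mul_nonneg hc0 hC0

/-- Physical tails of a uniformly bounded family are summable (geometric domination, ratio `Λ⁻²`). -/
theorem summable_physEnergy_tail_unif {ε₀ : ℝ} (hε : 0 < ε₀) {W : ℤ → ℝ → Em 4} (hU : UniformBound W)
    (n : ℤ) (σ : ℝ) : Summable (fun k : ℕ => physEnergy ε₀ W (n + k) σ) := by
  obtain ⟨C, hC⟩ := hU
  have hΛ : 0 < bigLam ε₀ := bigLam_pos (by linarith)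
  have hΛ1 : 1 < bigLam ε₀ := EternalViscousRate.DissipationEdge.one_lt_bigLam hε
  set r : ℝ := ((bigLam ε₀)⁻¹) ^ 2 with hr
  have hr0 : 0 ≤ r := by positivity
  have hr1 : r < 1 := by
    have h1 : (bigLam ε₀)⁻¹ < 1 := inv_lt_one_of_one_lt₀ hΛ1
    have h2 : 0 ≤ (bigLam ε₀)⁻¹ := inv_nonneg.mpr hΛ.le
    calc r = (bigLam ε₀)⁻¹ ^ 2 := hr
      _ < 1 ^ 2 := pow_lt_pow_left₀ h1 h2 (by norm_num)
      _ = 1 := one_pow 2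
  have hgeo : Summable (fun k : ℕ => ((bigLam ε₀ ^ n)⁻¹ ^ 2 * (Real.exp (2 * σ) * C ^ 2)) * r ^ k) :=
    (summable_geometric_of_lt_one hr0 hr1).mul_left _
  refine Summable.of_nonneg_of_le (fun k => physEnergy_nonneg _ _ _ _) (fun k => ?_) hgeo
  have hsplit : (bigLam ε₀ ^ (n + (k : ℤ)))⁻¹ ^ 2 = (bigLam ε₀ ^ n)⁻¹ ^ 2 * r ^ k := by
    rw [hr, zpow_add₀ hΛ.ne', zpow_natCast, mul_inv, mul_pow]
    congr 1
    rw [← inv_pow, ← pow_mul, ← pow_mul, mul_comm]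
  have hWk : ‖W (n + k) σ‖ ^ 2 ≤ C ^ 2 := by
    have h0 : 0 ≤ ‖W (n + k) σ‖ := norm_nonneg _
    exact pow_le_pow_left₀ h0 (hC _ _) 2
  have hA : 0 ≤ (bigLam ε₀ ^ (n + (k : ℤ)))⁻¹ ^ 2 := by positivity
  unfold physEnergy
  calc (bigLam ε₀ ^ (n + (k : ℤ)))⁻¹ ^ 2 * (Real.exp (2 * σ) * ‖W (n + k) σ‖ ^ 2)
      ≤ (bigLam ε₀ ^ (n + (k : ℤ)))⁻¹ ^ 2 * (Real.exp (2 * σ) * C ^ 2) :=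
        mul_le_mul_of_nonneg_left (mul_le_mul_of_nonneg_left hWk (Real.exp_pos _).le) hA
    _ = (bigLam ε₀ ^ n)⁻¹ ^ 2 * (Real.exp (2 * σ) * C ^ 2) * r ^ k := by rw [hsplit]; ring

/-- **`stub_tailLimit` (conveyor ledger) — PROVED.**  Final tails exist. -/
theorem stub_tailLimit : ∀ ε₀ : ℝ, 0 < ε₀ → ∀ α : Fin 4 → Fin 4 → Fin 4 → ℤ × ℤ × ℤ → ℝ, IsCancellingCoeff α → ∀ W : ℤ → ℝ → Em 4, IsEternal ε₀ α W → UniformBound W → ∀ n : ℤ, ∃ L : ℝ, Tendsto (fun σ => ∑' k : ℕ, physEnergy ε₀ W (n + k) σ) atTop (𝓝 L) := by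
  intro ε₀ hε α hc W hW hU n
  have hWv : IsEternalVisc ε₀ 0 α W := hW.isEternalVisc
  obtain ⟨C, hC⟩ := hU
  have hΛ : 0 < bigLam ε₀ := bigLam_pos (by linarith)
  have hΛ1 : 1 < bigLam ε₀ := EternalViscousRate.DissipationEdge.one_lt_bigLam hε
  have hCA : 0 ≤ fluxConst α := fluxConst_nonneg α
  have hC0 : 0 ≤ C := (norm_nonneg _).trans (hC 0 0)
  -- shell energies and their derivatives (inviscid: no dissipation term)
  set g : ℕ → ℝ → ℝ := fun k σ => physEnergy ε₀ W (n + k) σ with hg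
  set F : ℕ → ℝ → ℝ := fun k σ => physFlux ε₀ α W (n - 1 + k) σ with hF
  set g' : ℕ → ℝ → ℝ := fun k σ => F k σ - F (k + 1) σ with hg'
  have hder : ∀ (k : ℕ) (σ : ℝ), HasDerivAt (g k) (g' k σ) σ := by
    intro k σ
    have h := hasDerivAt_physEnergy hε hWv hc (n + k) σ
    refine h.congr_deriv ?_
    have e1 : n + (k : ℤ) - 1 = n - 1 + k := by ring
    have e2 : n + (k : ℤ) = n - 1 + ((k + 1 : ℕ) : ℤ) := by push_cast; ring
    simp only [hg', hF, viscCoef, zero_mul, mul_zero, sub_zero]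
    rw [e1, ← e2]
  -- geometric ratio
  set r : ℝ := ((bigLam ε₀)⁻¹) ^ 2 with hr
  have hr0 : 0 ≤ r := by positivity
  have hr1 : r < 1 := by
    have h1 : (bigLam ε₀)⁻¹ < 1 := inv_lt_one_of_one_lt₀ hΛ1
    have h2 : 0 ≤ (bigLam ε₀)⁻¹ := inv_nonneg.mpr hΛ.le
    calc r = (bigLam ε₀)⁻¹ ^ 2 := hr
      _ < 1 ^ 2 := pow_lt_pow_left₀ h1 h2 (by norm_num)
      _ = 1 := one_pow 2
  have hsplit : ∀ (j : ℤ) (k : ℕ), (bigLam ε₀ ^ (j + (k : ℤ)))⁻¹ ^ 2 = (bigLam ε₀ ^ j)⁻¹ ^ 2 * r ^ k := by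
    intro j k
    rw [hr, zpow_add₀ hΛ.ne', zpow_natCast, mul_inv, mul_pow]
    congr 1
    rw [← inv_pow, ← pow_mul, ← pow_mul, mul_comm]
  -- flux bound below a log-time `b`: |F k y| ≤ A b * r^k
  set c : ℝ := 2 * fluxConst α * (bigLam ε₀)⁻¹ * C with hc_def
  have hc0' : 0 ≤ c := by rw [hc_def]; positivity
  have hFb : ∀ (b : ℝ) (k : ℕ) (y : ℝ), y ≤ b →
      |F k y| ≤ c * ((bigLam ε₀ ^ (n - 1))⁻¹ ^ 2 * (Real.exp (2 * b) * C ^ 2)) * r ^ k := by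
    intro b k y hy
    have h := abs_physFlux_le_unif hε hc hC (n - 1 + k) hy
    rw [hsplit (n - 1) k] at h
    calc |F k y| = |physFlux ε₀ α W (n - 1 + k) y| := by rw [hF]
      _ ≤ 2 * fluxConst α * (bigLam ε₀)⁻¹ * C *
            ((bigLam ε₀ ^ (n - 1))⁻¹ ^ 2 * r ^ k * (Real.exp (2 * b) * C ^ 2)) := h
      _ = c * ((bigLam ε₀ ^ (n - 1))⁻¹ ^ 2 * (Real.exp (2 * b) * C ^ 2)) * r ^ k := by
            rw [hc_def]; ring
  -- F k σ → 0 as k → ∞ (fixed σ)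
  have hFlim : ∀ σ : ℝ, Tendsto (fun k : ℕ => F k σ) atTop (𝓝 0) := by
    intro σ
    set A : ℝ := c * ((bigLam ε₀ ^ (n - 1))⁻¹ ^ 2 * (Real.exp (2 * σ) * C ^ 2)) with hA
    have hgeo : Tendsto (fun k : ℕ => A * r ^ k) atTop (𝓝 0) := by
      have := (tendsto_pow_atTop_nhds_zero_of_lt_one hr0 hr1).const_mul A
      simpa using this
    refine squeeze_zero_norm (fun k => ?_) hgeo
    rw [Real.norm_eq_abs]
    exact hFb σ k σ le_rfl
  -- termwise differentiation of the tail on `Iio (σ + 1)`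
  have hsum0 : ∀ σ : ℝ, Summable (fun k : ℕ => g k σ) := by
    intro σ
    exact summable_physEnergy_tail_unif hε ⟨C, hC⟩ n σ
  have hT : ∀ σ : ℝ, HasDerivAt (fun z => ∑' k : ℕ, g k z) (∑' k : ℕ, g' k σ) σ := by
    intro σ
    set b : ℝ := σ + 1 with hb
    set A : ℝ := c * ((bigLam ε₀ ^ (n - 1))⁻¹ ^ 2 * (Real.exp (2 * b) * C ^ 2)) with hA
    have hA0 : 0 ≤ A := by rw [hA]; positivity
    have hu : Summable (fun k : ℕ => A * r ^ k + A * r ^ (k + 1)) :=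
      ((summable_geometric_of_lt_one hr0 hr1).mul_left A).add
        (((summable_geometric_of_lt_one hr0 hr1).mul_left (A * r)).congr fun k => by ring)
    refine hasDerivAt_tsum_of_isPreconnected hu isOpen_Iio isPreconnected_Iio
      (fun k y _ => hder k y) (fun k y hy => ?_) (show σ ∈ Iio b by simp [hb]) (hsum0 σ)
      (show σ ∈ Iio b by simp [hb])
    have hy' : y ≤ b := le_of_lt hy
    calc ‖g' k y‖ = |F k y - F (k + 1) y| := by rw [hg', Real.norm_eq_abs]
      _ ≤ |F k y| + |F (k + 1) y| := abs_sub _ _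
      _ ≤ A * r ^ k + A * r ^ (k + 1) := add_le_add (hFb b k y hy') (hFb b (k + 1) y hy')
  -- the derivative telescopes to the incoming flux `F 0 = F_{n-1}`
  have htele : ∀ σ : ℝ, ∑' k : ℕ, g' k σ = F 0 σ := by
    intro σ
    have hs : Summable (fun k : ℕ => g' k σ) := by
      set A : ℝ := c * ((bigLam ε₀ ^ (n - 1))⁻¹ ^ 2 * (Real.exp (2 * σ) * C ^ 2)) with hA
      have hu : Summable (fun k : ℕ => A * r ^ k + A * r ^ (k + 1)) :=
        ((summable_geometric_of_lt_one hr0 hr1).mul_left A).add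
          (((summable_geometric_of_lt_one hr0 hr1).mul_left (A * r)).congr fun k => by ring)
      refine Summable.of_norm_bounded hu fun k => ?_
      calc ‖g' k σ‖ = |F k σ - F (k + 1) σ| := by rw [hg', Real.norm_eq_abs]
        _ ≤ |F k σ| + |F (k + 1) σ| := abs_sub _ _
        _ ≤ A * r ^ k + A * r ^ (k + 1) := add_le_add (hFb σ k σ le_rfl) (hFb σ (k + 1) σ le_rfl)
    have h1 : Tendsto (fun K : ℕ => ∑ k ∈ Finset.range K, g' k σ) atTop (𝓝 (∑' k : ℕ, g' k σ)) :=
      hs.hasSum.tendsto_sum_nat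
    have h2 : Tendsto (fun K : ℕ => ∑ k ∈ Finset.range K, g' k σ) atTop (𝓝 (F 0 σ - 0)) := by
      have heq : (fun K : ℕ => ∑ k ∈ Finset.range K, g' k σ) = fun K => F 0 σ - F K σ := by
        funext K
        rw [hg']
        exact Finset.sum_range_sub' (fun k => F k σ) K
      rw [heq]
      exact tendsto_const_nhds.sub (hFlim σ)
    rw [sub_zero] at h2
    exact tendsto_nhds_unique h1 h2
  have hT' : ∀ σ : ℝ, HasDerivAt (fun z => ∑' k : ℕ, g k z) (F 0 σ) σ := fun σ =>
    (hT σ).congr_deriv (htele σ)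
  -- the incoming flux is integrable on a right half-line
  obtain ⟨σ₁, P₁, hP₁⟩ := hW.bdd (n - 1)
  obtain ⟨Mact, hact⟩ := hW.action
  set B₁ : ℝ := (bigLam ε₀ ^ (n - 1))⁻¹ ^ 2 * P₁ with hB₁
  set c₁ : ℝ := 2 * fluxConst α * (bigLam ε₀)⁻¹ with hc₁
  have hc₁0 : 0 ≤ c₁ := by rw [hc₁]; positivity
  have hdom : ∀ σ ∈ Ioi σ₁, ‖F 0 σ‖ ≤ c₁ * B₁ * ‖W n σ‖ := by
    intro σ hσ
    have hσ₁ : σ₁ ≤ σ := le_of_lt hσ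
    have hE : physEnergy ε₀ W (n - 1) σ ≤ B₁ := by
      rw [hB₁]; unfold physEnergy
      exact mul_le_mul_of_nonneg_left (hP₁ σ hσ₁) (sq_nonneg _)
    have h := abs_physFlux_le hε hc W (n - 1) σ
    simp only [sub_add_cancel] at h
    have hck : 0 ≤ c₁ * ‖W n σ‖ := mul_nonneg hc₁0 (norm_nonneg _)
    calc ‖F 0 σ‖ = |physFlux ε₀ α W (n - 1) σ| := by simp [hF, Real.norm_eq_abs]
      _ ≤ c₁ * ‖W n σ‖ * physEnergy ε₀ W (n - 1) σ := by simpa [hc₁, mul_assoc] using h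
      _ ≤ c₁ * ‖W n σ‖ * B₁ := mul_le_mul_of_nonneg_left hE hck
      _ = c₁ * B₁ * ‖W n σ‖ := by ring
  have hg_int : Integrable (fun σ => c₁ * B₁ * ‖W n σ‖) := ((hact n).1).const_mul (c₁ * B₁)
  have hF_eq : (fun σ => F 0 σ) = deriv (fun z => ∑' k : ℕ, g k z) := by
    funext σ; exact ((hT' σ).deriv).symm
  have hF_meas : AEStronglyMeasurable (fun σ => F 0 σ) (volume.restrict (Ioi σ₁)) := by
    rw [hF_eq]
    exact (measurable_deriv _).aestronglyMeasurable
  have hint : IntegrableOn (fun σ => F 0 σ) (Ioi σ₁) := by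
    refine Integrable.mono' hg_int.integrableOn hF_meas ?_
    exact (ae_restrict_iff' measurableSet_Ioi).mpr (ae_of_all _ hdom)
  exact ⟨_, tendsto_limUnder_of_hasDerivAt_of_integrableOn_Ioi (fun σ _ => hT' σ) hint⟩

/-- **Function form of `stub_tailLimit`** (the composition's `choose`): a uniformly bounded admissible eternal
solution of a cancelling table at scale ratio `1+ε₀ > 1` HAS a final-tail function `L : ℤ → ℝ` — the physical
tail energy above shell `n` tends to `L n` as `σ → ∞`, for every `n` — and every final tail is non-negative.
Model lattice ODEs only; nothing about NS. -/
theorem exists_finalTails {ε₀ : ℝ} (hε : 0 < ε₀) {α : Fin 4 → Fin 4 → Fin 4 → ℤ × ℤ × ℤ → ℝ}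
    (hc : IsCancellingCoeff α) {W : ℤ → ℝ → Em 4} (hW : IsEternal ε₀ α W) (hU : UniformBound W) :
    ∃ L : ℤ → ℝ, (∀ n : ℤ, Tendsto (fun σ => ∑' k : ℕ, physEnergy ε₀ W (n + k) σ) atTop (𝓝 (L n))) ∧
      ∀ n : ℤ, 0 ≤ L n := by
  choose L hL using stub_tailLimit ε₀ hε α hc W hW hU
  exact ⟨L, hL, fun n => ge_of_tendsto' (hL n) fun σ => tsum_nonneg fun k => physEnergy_nonneg _ _ _ _⟩

end Summit.NavierStokesRegularity.NavierStokesRegularity.Cruxes.EternalInviscidRate.FinalWakeLedger
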